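import Summits.ABC.ABC.Theses.AntisymmetricTwoTorsion
import Literature.NumberTheory.DiophantineGeometry.MinimalDiscriminantProofs
import HarnessLib

/-!
# Crux `TraceDefectPayoff` (stmt-ABC-23395), line `birth` — stub `stub_curveForm`

Registered stub `stub_curveForm` of the birth skeleton of crux stmt-ABC-23395 (route
`AntisymmetricTwoTorsion`, abc-idea-1 g2): the two-torsion dictionary IN CURVE FORM. Given
`TwoTorsionDictionary` (`|Δ_min (W)| ≤ |16 b² (a² − 4b)|` and `rad (b (a² − 4b)) ∣ 2 N_W` for
`W = ⟨0, a, 0, b, 0⟩`, `gcd (a, b) = 1`, `b (a² − 4b) ≠ 0`), with `M = max (4|b|, |a² − 4b|)`: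

* `log |Δ_min (W)| ≤ log 64 + 3 log M` — since `16 b² = (4|b|)² ≤ M²` and `|a² − 4b| ≤ M`, so
  `|16 b² (a² − 4b)| ≤ M³ ≤ 64 M³`;
* `rad (b (a² − 4b)) ≤ 2 N_W` (a divisor of the positive integer `2 N_W`);
* `1 ≤ N_W` (`WeierstrassCurve.conductorNorm_pos_holds`).

Pure bookkeeping; NOT abc, moves no rung (the line serves the class corollary
`TraceDefectSubexpSzpiro` of rung A1′, itself NOT abc and NOT A-PS).

## References

* J. H. Silverman, *The Arithmetic of Elliptic Curves*, GTM 106, 2nd ed. 2009, VII.1, VIII.8.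
  [SilvermanAEC2009]
-/

-- `Summit.<Summit>.<Problem>` is the mandated summit-side namespace (CONVENTIONS §2); for the
-- single-conjunct summit `ABC` the two coincide, so the duplicate `ABC.ABC` is deliberate.
set_option linter.dupNamespace false

namespace Summit.ABC.ABC.Theorems.TraceDefectPayoffLine

open UniqueFactorizationMonoid
open Summit.ABC.ABC.Theses.AntisymmetricTwoTorsion

/-- `|16 b² (a² − 4b)| ≤ 64 M³` with `M = max (4|b|, |a² − 4b|)`, as real numbers. [folklore] -/
theorem abs_disc_le_cube_max (a b : ℤ) :
    |(16 : ℝ) * (b : ℝ) ^ 2 * ((a : ℝ) ^ 2 - 4 * (b : ℝ))| ≤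
      64 * ((max (4 * |b|) |a ^ 2 - 4 * b| : ℤ) : ℝ) ^ 3 := by
  set M : ℤ := max (4 * |b|) |a ^ 2 - 4 * b| with hM
  have h1 : 4 * |b| ≤ M := le_max_left _ _
  have h2 : |a ^ 2 - 4 * b| ≤ M := le_max_right _ _
  have hM0 : 0 ≤ M := (abs_nonneg _).trans h2
  -- in `ℤ`: `|16 b² (a² − 4b)| = (4|b|)² · |a² − 4b| ≤ M² · M ≤ 64 M³`
  have hZ : |16 * b ^ 2 * (a ^ 2 - 4 * b)| ≤ 64 * M ^ 3 := by
    rw [abs_mul, show |16 * b ^ 2| = (4 * |b|) ^ 2 by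
      rw [abs_of_nonneg (by positivity : (0 : ℤ) ≤ 16 * b ^ 2), mul_pow, sq_abs]; ring]
    have h3 : (4 * |b|) ^ 2 ≤ M ^ 2 := pow_le_pow_left₀ (by positivity) h1 2
    calc (4 * |b|) ^ 2 * |a ^ 2 - 4 * b| ≤ M ^ 2 * M :=
          mul_le_mul h3 h2 (abs_nonneg _) (by positivity)
      _ = M ^ 3 := by ring
      _ ≤ 64 * M ^ 3 := by nlinarith [pow_nonneg hM0 3]
  have hR : ((|16 * b ^ 2 * (a ^ 2 - 4 * b)| : ℤ) : ℝ) ≤ ((64 * M ^ 3 : ℤ) : ℝ) := by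
    exact_mod_cast hZ
  simpa [Int.cast_abs, Int.cast_mul, Int.cast_pow] using hR

/-- **Stub `stub_curveForm` of line `birth` (crux stmt-ABC-23395).** The two-torsion dictionary in
curve form: `log |Δ_min (W)| ≤ log 64 + 3 log M`, `rad (b (a² − 4b)) ≤ 2 N_W`, `1 ≤ N_W` for
`W = ⟨0, a, 0, b, 0⟩`, `M = max (4|b|, |a² − 4b|)`. [cite: SilvermanAEC2009, VII.1 Remark 1.1 and VIII.8] -/
theorem stub_curveForm : TwoTorsionDictionary → ∀ a b : ℤ, IsCoprime a b → b ≠ 0 → a ^ 2 - 4 * b ≠ 0 → ∀ (W : WeierstrassCurve ℚ) [W.IsElliptic], W = ⟨0, (a : ℚ), 0, (b : ℚ), 0⟩ → Real.log (W.minimalDiscriminantNorm ℤ : ℝ) ≤ Real.log 64 + 3 * Real.log ((max (4 * |b|) |a ^ 2 - 4 * b| : ℤ) : ℝ) ∧ (((radical (b * (a ^ 2 - 4 * b))).natAbs : ℕ) : ℝ) ≤ 2 * (W.conductorNorm ℤ : ℝ) ∧ (1 : ℝ) ≤ (W.conductorNorm ℤ : ℝ) := by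
  intro hD a b hab hb hd W _ hW
  obtain ⟨hΔ, hrad⟩ := hD a b hab hb hd W hW
  set M : ℤ := max (4 * |b|) |a ^ 2 - 4 * b| with hM
  have hM1 : (1 : ℤ) ≤ M :=
    (Int.one_le_abs hd).trans (le_max_right _ _)
  have hMpos : (0 : ℝ) < (M : ℝ) := by exact_mod_cast hM1
  have hD0 : (0 : ℝ) < (W.minimalDiscriminantNorm ℤ : ℝ) := by
    exact_mod_cast WeierstrassCurve.minimalDiscriminantNorm_pos_holds W
  have hNpos : 0 < W.conductorNorm ℤ := WeierstrassCurve.conductorNorm_pos_holds W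
  refine ⟨?_, ?_, by exact_mod_cast hNpos⟩
  · -- `log |Δ_min| ≤ log (64 M³) = log 64 + 3 log M`
    have h1 : (W.minimalDiscriminantNorm ℤ : ℝ) ≤ 64 * (M : ℝ) ^ 3 :=
      hΔ.trans (abs_disc_le_cube_max a b)
    have h2 : Real.log (W.minimalDiscriminantNorm ℤ : ℝ) ≤ Real.log (64 * (M : ℝ) ^ 3) :=
      Real.log_le_log hD0 h1
    rw [Real.log_mul (by norm_num) (by positivity), Real.log_pow] at h2
    exact_mod_cast h2
  · -- `rad ∣ 2 N`, `2 N > 0`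
    exact_mod_cast Nat.le_of_dvd (by positivity) hrad

end Summit.ABC.ABC.Theorems.TraceDefectPayoffLine
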